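import Summits.QuantumAdvantage.QuantumAdvantage.Theorems.SymplecticPurityDeqThesisCoreRealDefs

/-!
# Crux `DeqThesis`, line `Sketch` — real-tilt core, file 2/4: pair decomposition, APN bound, diagonal term

`pair_decomposition`: `⟨g|⊗R|g⟩ = Σ_d pw_in(d) · J(d)` (regroup the double sum over the graph by the data difference);
`J_trivial_bound`: `|J d| ≤ 2 ∏_{out}(|c|+|s|)` for `d ≠ 0` (APN: each value difference taken ≤ 2 times);
`diag_term_bound`: the `d = 0` term is `∏c · (Walsh sum of the cube) ≤ 2√2ⁿ`. Registered alias: `stub_coreRealPairs`.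
-/

set_option linter.dupNamespace false -- D-0017: single-problem summit ⇒ `QuantumAdvantage.QuantumAdvantage` by design

noncomputable section

namespace Summit.QuantumAdvantage.QuantumAdvantage.Theorems.SymplecticPurity

open Matrix Finset
open Literature.Computability.QuantumComplexity Literature.Computability.Cryptography

namespace CoreReal

variable {n : ℕ}

section Statements

variable {K : Type} [Field K] [Fintype K] [Algebra (ZMod 2) K]

/-! ### The pair decomposition and the bounds -/

omit [Fintype K] [Algebra (ZMod 2) K] in
/-- PAIR DECOMPOSITION: the expectation in the unnormalised graph vector, regrouped by the data
difference. -/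
theorem pair_decomposition (e : K ≃+ (Fin n → ZMod 2))
    (A : Finset (Fin (n + n))) (c s : Fin (n + n) → ℝ) :
    star (graphVec e) ⬝ᵥ (tensorAll (siteOp A c s)) *ᵥ (graphVec e) =
      ((∑ d : Fin n → Bool, pw (inSupp A) (fun i => c (Fin.castAdd n i)) (fun i => s (Fin.castAdd n i)) d *
        J e A c s d : ℝ) : ℂ) := by
  classical
  set F : QReg n → QReg n := cubeCoords e with hF
  set M := siteOp A c s with hM
  -- (a) double sum over the graph points
  have hs : ∀ (p : Prop) [Decidable p] (X : ℂ), star (if p then (1 : ℂ) else 0) * X = if p then X else 0 := by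
    intro p _ X; split_ifs <;> simp
  have hs' : ∀ (p : Prop) [Decidable p] (X : ℂ), X * (if p then (1 : ℂ) else 0) = if p then X else 0 := by
    intro p _ X; split_ifs <;> simp
  have ha : star (graphVec e) ⬝ᵥ (tensorAll M) *ᵥ (graphVec e) =
      ∑ x : QReg n, ∑ x' : QReg n, tensorAll M (Fin.append x (F x)) (Fin.append x' (F x')) := by
    simp only [dotProduct, Matrix.mulVec, Pi.star_apply, graphVec, hs]
    rw [sum_graph_indicator]
    refine Finset.sum_congr rfl fun x _ => ?_
    simp only [hs']
    rw [sum_graph_indicator]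
  -- (b) split the product over the two registers
  have hb : ∀ x x' : QReg n, tensorAll M (Fin.append x (F x)) (Fin.append x' (F x')) =
      (∏ i : Fin n, M (Fin.castAdd n i) (x i) (x' i)) * ∏ j : Fin n, M (Fin.natAdd n j) (F x j) (F x' j) := by
    intro x x'
    rw [tensorAll_apply, Fin.prod_univ_add]
    simp only [Fin.append_left, Fin.append_right]
  -- (c) reindex `x' = x ⊕ d` and swap
  have hc : ∑ x : QReg n, ∑ x' : QReg n, tensorAll M (Fin.append x (F x)) (Fin.append x' (F x')) =
      ∑ d : QReg n, ∑ x : QReg n,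
        tensorAll M (Fin.append x (F x)) (Fin.append (fun i => Bool.xor (x i) (d i)) (F fun i => Bool.xor (x i) (d i))) := by
    calc ∑ x : QReg n, ∑ x' : QReg n, tensorAll M (Fin.append x (F x)) (Fin.append x' (F x'))
        = ∑ x : QReg n, ∑ d : QReg n,
            tensorAll M (Fin.append x (F x)) (Fin.append (fun i => Bool.xor (x i) (d i)) (F fun i => Bool.xor (x i) (d i))) :=
          Finset.sum_congr rfl fun x _ =>
            (Equiv.sum_comp (xorEquiv x) (fun x' => tensorAll M (Fin.append x (F x)) (Fin.append x' (F x')))).symm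
      _ = _ := Finset.sum_comm
  -- (d) per-site factorisation along the flip pattern
  have hin : ∀ d x : QReg n, (∏ i : Fin n, M (Fin.castAdd n i) (x i) (Bool.xor (x i) (d i))) =
      ((pw (inSupp A) (fun i => c (Fin.castAdd n i)) (fun i => s (Fin.castAdd n i)) d : ℝ) : ℂ) *
        ((sgn (inSupp A) d x : ℝ) : ℂ) := by
    intro d x
    rw [pw, sgn, Complex.ofReal_prod, Complex.ofReal_prod, ← Finset.prod_mul_distrib]
    refine Finset.prod_congr rfl fun i _ => ?_
    rw [hM, siteOp_apply_xor]
    simp only [mem_inSupp]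
  have hout : ∀ d x : QReg n,
      (∏ j : Fin n, M (Fin.natAdd n j) (F x j) (F (fun i => Bool.xor (x i) (d i)) j)) =
      ((pw (outSupp A) (fun j => c (Fin.natAdd n j)) (fun j => s (Fin.natAdd n j)) (T e d x) : ℝ) : ℂ) *
        ((sgn (outSupp A) (T e d x) (F x) : ℝ) : ℂ) := by
    intro d x
    rw [hF, cubeCoords_xor e d x, ← hF]
    rw [pw, sgn, Complex.ofReal_prod, Complex.ofReal_prod, ← Finset.prod_mul_distrib]
    refine Finset.prod_congr rfl fun j _ => ?_
    rw [hM, siteOp_apply_xor]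
    simp only [mem_outSupp]
  -- assemble
  rw [ha, hc]
  simp_rw [hb, hin, hout]
  rw [Complex.ofReal_sum]
  refine Finset.sum_congr rfl fun d _ => ?_
  rw [J, Complex.ofReal_mul, Complex.ofReal_sum, Finset.mul_sum]
  refine Finset.sum_congr rfl fun x _ => ?_
  push_cast
  ring

omit [Algebra (ZMod 2) K] in
/-- APN in coordinates: along `d ≠ 0` every value-difference pattern is taken at most twice. -/
theorem card_filter_T_eq_le_two (hK : Fintype.card K = 2 ^ n) (e : K ≃+ (Fin n → ZMod 2))
    (d : Fin n → Bool) (hd : d ≠ fun _ => false) (t : Fin n → Bool) :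
    (Finset.univ.filter fun y : Fin n → Bool => T e d y = t).card ≤ 2 := by
  classical
  have hα : toK e d ≠ 0 := toK_ne_zero e hd
  refine le_trans (Finset.card_le_card_of_injOn (toK e) ?_ ?_)
    (card_filter_cube_diff_le_two (two_eq_zero_of_card hK) (toK e d) (toK e t) (Or.inl hα))
  · intro y hy
    rw [Finset.mem_coe, Finset.mem_filter] at hy ⊢
    refine ⟨Finset.mem_univ _, ?_⟩
    have h := congrArg (toK e) hy.2
    rw [T_eq_bits, toK_bits] at h
    exact h
  · intro y₁ _ y₂ _ h
    exact (bitsEquiv e).injective h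

omit [Fintype K] [Algebra (ZMod 2) K] in
/-- `|sgn| = 1`. -/
theorem abs_sgn (S : Finset (Fin n)) (d y : Fin n → Bool) : |sgn S d y| = 1 := by
  rw [sgn, Finset.abs_prod]
  refine Finset.prod_eq_one fun i _ => ?_
  split_ifs <;> simp

omit [Algebra (ZMod 2) K] in
/-- TRIVIAL BOUND on `J d`, `d ≠ 0` (APN). -/
theorem J_trivial_bound (hK : Fintype.card K = 2 ^ n) (e : K ≃+ (Fin n → ZMod 2))
    (A : Finset (Fin (n + n))) (c s : Fin (n + n) → ℝ) (d : Fin n → Bool) (hd : d ≠ fun _ => false) :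
    |J e A c s d| ≤ 2 * ∏ j ∈ outSupp A, (|c (Fin.natAdd n j)| + |s (Fin.natAdd n j)|) := by
  classical
  set c' : Fin n → ℝ := fun j => c (Fin.natAdd n j) with hc'
  set s' : Fin n → ℝ := fun j => s (Fin.natAdd n j) with hs'
  -- `|J| ≤ Σ_y |pw (T y)|`
  have h1 : |J e A c s d| ≤ ∑ y : Fin n → Bool, |pw (outSupp A) c' s' (T e d y)| := by
    rw [J]
    refine (Finset.abs_sum_le_sum_abs _ _).trans (Finset.sum_le_sum fun y _ => ?_)
    rw [abs_mul, abs_mul, abs_sgn, abs_sgn, one_mul, mul_one]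
  -- group by the value of `T`
  have h2 : ∑ y : Fin n → Bool, |pw (outSupp A) c' s' (T e d y)| ≤
      ∑ t : Fin n → Bool, 2 * |pw (outSupp A) c' s' t| := by
    rw [← Finset.sum_fiberwise_of_maps_to (g := fun y => T e d y) (t := Finset.univ) (fun _ _ => Finset.mem_univ _)]
    refine Finset.sum_le_sum fun t _ => ?_
    rw [Finset.sum_congr rfl (fun y hy => by rw [(Finset.mem_filter.1 hy).2]), Finset.sum_const, nsmul_eq_mul]
    refine mul_le_mul_of_nonneg_right ?_ (abs_nonneg _)
    exact_mod_cast card_filter_T_eq_le_two hK e d hd t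
  calc |J e A c s d| ≤ ∑ t : Fin n → Bool, 2 * |pw (outSupp A) c' s' t| := h1.trans h2
    _ = 2 * ∏ j ∈ outSupp A, (|c' j| + |s' j|) := by rw [← Finset.mul_sum, sum_abs_pw_eq]

omit [Fintype K] [Algebra (ZMod 2) K] in
/-- `toK 0 = 0`. -/
theorem toK_zero (e : K ≃+ (Fin n → ZMod 2)) : toK e (fun _ : Fin n => false) = 0 := by
  rw [toK]
  convert map_zero e.symm using 2
  funext i
  simp

omit [Fintype K] [Algebra (ZMod 2) K] in
/-- `bits 0 = 0`. -/
theorem bits_zero (e : K ≃+ (Fin n → ZMod 2)) : bits e (0 : K) = fun _ => false := by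
  funext i; simp [bits]

omit [Fintype K] [Algebra (ZMod 2) K] in
/-- Along `d = 0` the value difference vanishes. -/
theorem T_zero (e : K ≃+ (Fin n → ZMod 2)) (y : Fin n → Bool) : T e (fun _ => false) y = fun _ => false := by
  rw [T_eq_bits, toK_zero, add_zero, ← bits_zero e]
  congr 1
  -- `u³ + u³ = 0` in characteristic two… via `x + x = 0` for the `ZMod 2`-vector image
  apply e.injective
  rw [map_add, map_zero]
  funext i
  rw [Pi.add_apply, Pi.zero_apply]
  rcases zmod_two_eq_zero_or_eq_one (e (toK e y ^ 3) i) with h | h <;> rw [h] <;> decide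

omit [Fintype K] [Algebra (ZMod 2) K] in
/-- `|pw S c s 0| ≤ 1` on the unit circle. -/
theorem abs_pw_zero_le (S : Finset (Fin n)) (c s : Fin n → ℝ) (hcs : ∀ i ∈ S, c i ^ 2 + s i ^ 2 = 1) :
    |pw S c s (fun _ => false)| ≤ 1 := by
  rw [pw, Finset.abs_prod]
  refine Finset.prod_le_one (fun i _ => abs_nonneg _) fun i _ => ?_
  by_cases hi : i ∈ S
  · simp only [hi, if_true, Bool.false_eq_true, if_false]
    have h := hcs i hi
    have : |c i| ^ 2 ≤ 1 := by rw [sq_abs]; nlinarith [sq_nonneg (s i)]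
    nlinarith [abs_nonneg (c i)]
  · simp [hi]

omit [Fintype K] [Algebra (ZMod 2) K] in
/-- A coordinate-sum functional vanishes identically only on the empty set. -/
theorem coordSum_ne_zero (e : K ≃+ (Fin n → ZMod 2)) {S : Finset (Fin n)} (hS : S.Nonempty) :
    coordSum e S ≠ 0 := by
  classical
  obtain ⟨j, hj⟩ := hS
  intro h
  have h1 := DFunLike.congr_fun h (e.symm (Pi.single j 1))
  rw [coordSum_apply, AddEquiv.apply_symm_apply, AddMonoidHom.zero_apply,
    Finset.sum_eq_single j] at h1
  · simp at h1
  · intro i _ hij; simp [hij]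
  · intro h'; exact absurd hj h'

omit [Algebra (ZMod 2) K] in
/-- DIAGONAL TERM: `d = 0`. -/
theorem diag_term_bound (hK : Fintype.card K = 2 ^ n) (e : K ≃+ (Fin n → ZMod 2))
    (A : Finset (Fin (n + n))) (hA : A.Nonempty) (c s : Fin (n + n) → ℝ) (hcs : ∀ k, c k ^ 2 + s k ^ 2 = 1) :
    |pw (inSupp A) (fun i => c (Fin.castAdd n i)) (fun i => s (Fin.castAdd n i)) (fun _ => false) *
        J e A c s (fun _ => false)| ≤ 2 * Real.sqrt 2 ^ n := by
  classical
  set φ : K →+ ZMod 2 := coordSum e (inSupp A) with hφ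
  set ψ : K →+ ZMod 2 := coordSum e (outSupp A) with hψ
  -- the `d = 0` pair sum is `pwOut 0 · Σ_u χ(φ u + ψ (u³))`
  have hJ : J e A c s (fun _ => false) =
      pw (outSupp A) (fun j => c (Fin.natAdd n j)) (fun j => s (Fin.natAdd n j)) (fun _ => false) *
        ∑ u : K, (if φ u + ψ (u ^ 3) = 0 then (1 : ℝ) else -1) := by
    rw [J, Finset.mul_sum]
    simp_rw [T_zero]
    rw [← Equiv.sum_comp (bitsEquiv e).symm]
    refine Finset.sum_congr rfl fun u _ => ?_
    have hu : (bitsEquiv e).symm u = bits e u := rfl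
    rw [hu, cubeCoords_eq_bits, toK_bits, sgn_bits_eq, sgn_bits_eq, ← sign_mul_sign]
    have hf1 : (inSupp A).filter (fun i => (false : Bool) = false) = inSupp A := Finset.filter_true_of_mem fun _ _ => rfl
    have hf2 : (outSupp A).filter (fun i => (false : Bool) = false) = outSupp A := Finset.filter_true_of_mem fun _ _ => rfl
    rw [hf1, hf2]
    ring
  -- the character sum is a Walsh coefficient of the cube (or vanishes)
  have hW : |∑ u : K, (if φ u + ψ (u ^ 3) = 0 then (1 : ℝ) else -1)| ≤ 2 * Real.sqrt 2 ^ n := by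
    by_cases hout : (outSupp A).Nonempty
    · exact abs_walsh_cube_le hK φ ψ (coordSum_ne_zero e hout)
    · -- no output support: `ψ = 0`, `φ ≠ 0`, the sum vanishes
      have hψ0 : ψ = 0 := by
        rw [Finset.not_nonempty_iff_eq_empty] at hout
        ext u; rw [hψ, coordSum_apply, hout]; simp
      have hin : (inSupp A).Nonempty := by
        obtain ⟨k, hk⟩ := hA
        induction k using Fin.addCases with
        | left i => exact ⟨i, (mem_inSupp A i).2 hk⟩
        | right j =>
          exfalso
          rw [Finset.not_nonempty_iff_eq_empty] at hout
          have : j ∈ outSupp A := (mem_outSupp A j).2 hk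
          rw [hout] at this
          exact absurd this (Finset.notMem_empty _)
      have h0 : ∑ u : K, (if φ u + ψ (u ^ 3) = 0 then (1 : ℝ) else -1) = 0 := by
        simp_rw [hψ0, AddMonoidHom.zero_apply, add_zero]
        exact sum_sign_eq_zero φ (coordSum_ne_zero e hin)
      rw [h0, abs_zero]; positivity
  rw [hJ, ← mul_assoc, abs_mul, abs_mul]
  have h1 := abs_pw_zero_le (inSupp A) (fun i => c (Fin.castAdd n i)) (fun i => s (Fin.castAdd n i))
    fun i _ => hcs _
  have h2 := abs_pw_zero_le (outSupp A) (fun j => c (Fin.natAdd n j)) (fun j => s (Fin.natAdd n j))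
    fun j _ => hcs _
  calc |pw (inSupp A) (fun i => c (Fin.castAdd n i)) (fun i => s (Fin.castAdd n i)) (fun _ => false)| *
        |pw (outSupp A) (fun j => c (Fin.natAdd n j)) (fun j => s (Fin.natAdd n j)) (fun _ => false)| *
        |∑ u : K, (if φ u + ψ (u ^ 3) = 0 then (1 : ℝ) else -1)|
      ≤ 1 * 1 * (2 * Real.sqrt 2 ^ n) := by
        gcongr
    _ = 2 * Real.sqrt 2 ^ n := by ring


end Statements

end CoreReal

/-- Registered alias (file 2/4 of the real-tilt core): the APN bound on the pair sum. -/
theorem stub_coreRealPairs : ∀ {n : ℕ} {K : Type} [Field K] [Fintype K], Fintype.card K = 2 ^ n → ∀ (e : K ≃+ (Fin n → ZMod 2)) (A : Finset (Fin (n + n))) (c s : Fin (n + n) → ℝ) (d : Fin n → Bool), d ≠ (fun _ => false) → |Summit.QuantumAdvantage.QuantumAdvantage.Theorems.SymplecticPurity.CoreReal.J e A c s d| ≤ 2 * ∏ j ∈ Summit.QuantumAdvantage.QuantumAdvantage.Theorems.SymplecticPurity.CoreReal.outSupp A, (|c (Fin.natAdd n j)| + |s (Fin.natAdd n j)|) 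:=
  fun hK e A c s d hd => CoreReal.J_trivial_bound hK e A c s d hd

end Summit.QuantumAdvantage.QuantumAdvantage.Theorems.SymplecticPurity

end
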